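import Literature.Probability.LatticeModels.GibbsTailConditioning
import HarnessLib

/-!
# Triviality of the product-tail σ-algebra under a product of tail-trivial measures

Topic `Probability/LatticeModels`. Georgii–Higuchi 2000, proof of Lemma 5.4 (p. 14): in the
duplicated system `ν = μ ⊗ μ'` the events used are "measurable with respect to the 'product-tail'
`𝒯⁽²⁾ = ⋂ {𝓕_{Λᶜ} ⊗ 𝓕_{Λᶜ} : Λ ⊂ ℤ² finite}` in `Ω²`, which is trivial by Fubini's theorem.
(One should not be mistaken to believe that `A` was measurable with respect to the smaller
'tail-product' `𝒯 ⊗ 𝒯`. It is only the case that the `ω`-section `A_ω` of `A` belongs to `𝒯`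
for any `ω`, and the function `ω → μ(A_ω)` is `𝒯`-measurable.)" The same triviality is used at
the end of the proof of Lemma 5.5. We prove it:

* `prodTailEvents V S` — `𝒯⁽²⁾`;
* `measurableSet_tail_section` — sections of product-tail events are tail events;
* `measurable_tail_measure_section` — `ω ↦ μ'(A_ω)` is tail measurable;
* **`IsTailTrivial.prod`** — `μ, μ'` tail trivial ⇒ `(μ ⊗ μ')(A) ∈ {0, 1}` for `A ∈ 𝒯⁽²⁾`.

## References

* H.-O. Georgii, Y. Higuchi, J. Math. Phys. 41 (2000), proof of Lemma 5.4 (p. 14)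
  [GeorgiiHiguchi2000].
-/

noncomputable section

open MeasureTheory
open scoped ENNReal

namespace Literature.Probability.LatticeModels

variable {V S : Type*} [MeasurableSpace S]

variable (V S) in
/-- The **product-tail σ-algebra** `𝒯⁽²⁾ = ⋂_Λ 𝓕_{Λᶜ} ⊗ 𝓕_{Λᶜ}` on pairs of configurations. [cite: GeorgiiHiguchi2000, Lemma 5.4 (proof, p. 14)] -/
@[implicit_reducible]
def prodTailEvents : MeasurableSpace ((V → S) × (V → S)) :=
  ⨅ Λ : Finset V, (cylinderEvents (X := fun _ : V => S) ((↑Λ : Set V)ᶜ)).prod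
    (cylinderEvents (X := fun _ : V => S) ((↑Λ : Set V)ᶜ))

/-- A set is a product-tail event iff it belongs to `𝓕_{Λᶜ} ⊗ 𝓕_{Λᶜ}` for every finite `Λ`. [cite: GeorgiiHiguchi2000, Lemma 5.4 (proof, p. 14)] -/
theorem measurableSet_prodTailEvents_iff {A : Set ((V → S) × (V → S))} :
    MeasurableSet[prodTailEvents V S] A ↔ ∀ Λ : Finset V,
      MeasurableSet[(cylinderEvents (X := fun _ : V => S) ((↑Λ : Set V)ᶜ)).prod
        (cylinderEvents (X := fun _ : V => S) ((↑Λ : Set V)ᶜ))] A :=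
  MeasurableSpace.measurableSet_iInf

/-- `𝓕_{Λᶜ} ⊗ 𝓕_{Λᶜ}` is a sub-σ-algebra of the product σ-algebra. [folklore] -/
theorem prod_cylinderEvents_le (Λ : Finset V) :
    (cylinderEvents (X := fun _ : V => S) ((↑Λ : Set V)ᶜ)).prod (cylinderEvents (X := fun _ : V => S) ((↑Λ : Set V)ᶜ)) ≤
      (Prod.instMeasurableSpace : MeasurableSpace ((V → S) × (V → S))) := by
  refine sup_le ?_ ?_
  · exact (MeasurableSpace.comap_mono cylinderEvents_le_pi).trans le_sup_left
  · exact (MeasurableSpace.comap_mono cylinderEvents_le_pi).trans le_sup_right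

/-- Product-tail events are measurable. [folklore] -/
theorem MeasurableSet.of_prodTailEvents {A : Set ((V → S) × (V → S))} (hA : MeasurableSet[prodTailEvents V S] A) :
    MeasurableSet A :=
  prod_cylinderEvents_le (∅ : Finset V) _ ((measurableSet_prodTailEvents_iff.1 hA) ∅)

/-- **Sections of product-tail events are tail events** (the `ω`-section `A_ω ∈ 𝒯`). [cite: GeorgiiHiguchi2000, Lemma 5.4 (proof, p. 14)] -/
theorem measurableSet_tail_section {A : Set ((V → S) × (V → S))} (hA : MeasurableSet[prodTailEvents V S] A) (ω : V → S) :
    MeasurableSet[tailEvents V S] (Prod.mk ω ⁻¹' A) := by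
  rw [measurableSet_tailEvents_iff]
  intro Λ
  have hAΛ := (measurableSet_prodTailEvents_iff.1 hA) Λ
  -- the map `ω' ↦ (ω, ω')` is measurable from `𝓕_{Λᶜ}` to `𝓕_{Λᶜ} ⊗ 𝓕_{Λᶜ}`
  -- work with the local instances `𝓕_{Λᶜ}` on both factors
  letI m : MeasurableSpace (V → S) := cylinderEvents (X := fun _ : V => S) ((↑Λ : Set V)ᶜ)
  have hm : Measurable[m, m.prod m] (Prod.mk ω) := by
    have h1 : Measurable[m, m] (fun _ : V → S => ω) := @measurable_const _ _ m m ω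
    have h2 : Measurable[m, m] (fun ω' : V → S => ω') := @measurable_id _ m
    exact @Measurable.prodMk (V → S) m (V → S) (V → S) m m _ _ h1 h2
  exact hm hAΛ

/-- **`ω ↦ μ'(A_ω)` is tail measurable** for a product-tail event `A` and an s-finite `μ'`. [cite: GeorgiiHiguchi2000, Lemma 5.4 (proof, p. 14)] -/
theorem measurable_tail_measure_section (μ' : Measure (V → S)) [SFinite μ'] {A : Set ((V → S) × (V → S))}
    (hA : MeasurableSet[prodTailEvents V S] A) :
    Measurable[tailEvents V S] fun ω => μ' (Prod.mk ω ⁻¹' A) := by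
  -- measurable for every `𝓕_{Λᶜ}` on the first factor (and the full σ-algebra on the second)
  have hΛ : ∀ Λ : Finset V, Measurable[cylinderEvents (X := fun _ : V => S) ((↑Λ : Set V)ᶜ)] fun ω => μ' (Prod.mk ω ⁻¹' A) := by
    intro Λ
    have hAΛ := (measurableSet_prodTailEvents_iff.1 hA) Λ
    have hA' : MeasurableSet[(cylinderEvents (X := fun _ : V => S) ((↑Λ : Set V)ᶜ)).prod MeasurableSpace.pi] A := by
      refine (sup_le_sup_left (MeasurableSpace.comap_mono cylinderEvents_le_pi) _) _ hAΛ
    exact @measurable_measure_prodMk_left _ _ (cylinderEvents (X := fun _ : V => S) ((↑Λ : Set V)ᶜ)) _ μ' _ _ hA'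
  -- hence measurable for the infimum
  rw [measurable_iff_comap_le]
  refine le_iInf fun Λ => ?_
  exact measurable_iff_comap_le.1 (hΛ Λ)

/-- **Fubini triviality of the product tail** (Georgii–Higuchi 2000, proof of Lemma 5.4: "`𝒯⁽²⁾`
is trivial by Fubini's theorem"): if `μ` and `μ'` are tail trivial (and s-finite), every
product-tail event has `μ ⊗ μ'`-measure `0` or `1`. [cite: GeorgiiHiguchi2000, Lemma 5.4 (proof, p. 14)] -/
theorem IsTailTrivial.prod {μ μ' : Measure (V → S)} [SFinite μ] [SFinite μ'] (hμ : IsTailTrivial μ) (hμ' : IsTailTrivial μ')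
    {A : Set ((V → S) × (V → S))} (hA : MeasurableSet[prodTailEvents V S] A) :
    μ.prod μ' A = 0 ∨ μ.prod μ' A = 1 := by
  have hAm : MeasurableSet A := MeasurableSet.of_prodTailEvents hA
  -- the sections have measure `0` or `1`
  have hsec : ∀ ω, μ' (Prod.mk ω ⁻¹' A) = 0 ∨ μ' (Prod.mk ω ⁻¹' A) = 1 := fun ω =>
    hμ' _ (measurableSet_tail_section hA ω)
  set B : Set (V → S) := {ω | μ' (Prod.mk ω ⁻¹' A) = 1} with hB
  have hBt : MeasurableSet[tailEvents V S] B :=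
    measurable_tail_measure_section μ' hA (measurableSet_singleton 1)
  have hBm : MeasurableSet B := MeasurableSet.of_tailEvents hBt
  -- `(μ ⊗ μ')(A) = ∫ μ'(A_ω) dμ = μ(B)`
  have hprod : μ.prod μ' A = μ B := by
    rw [Measure.prod_apply hAm, ← lintegral_indicator_one hBm]
    refine lintegral_congr fun ω => ?_
    by_cases hω : ω ∈ B
    · rw [Set.indicator_of_mem hω, Pi.one_apply]; exact hω
    · rw [Set.indicator_of_notMem hω]
      rcases hsec ω with h | h
      · exact h
      · exact absurd h hω
  rw [hprod]
  exact hμ B hBt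

end Literature.Probability.LatticeModels
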